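import Summits.BirchSwinnertonDyer.Rank1Residual.GaloisImage.KolyvaginDerivativeAlgebra
import Mathlib.Algebra.Group.Submonoid.Basic

/-!
# The augmentation-square lemma for the Kolyvagin derivative of an Euler family whose Euler
# factors are squares of augmentation elements (pure algebra) — file 1 of row T-DER-TR
# (THEOREM D-tr of T-DER: the derivative class is transverse at the primes of its level;
# cell `b2b-bsdres`, team n1011, seat p15 GEN 8, OWNERS row T-DER-TR = skel/T-DER-TR.md)

HONEST FRAMING (cell `b2b-bsdres`, run/shared/lean/b2b/bsd-rank1-residual/, verbatim in every
file): the goal of the cell is to DELETE the COMBINATION-SHAPED residual classes of the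
Birch–Swinnerton-Dyer formula for ALL analytic-rank `≤ 1` elliptic curves over `ℚ` — "full BSD
formula for every rank `≤ 1` curve in class `C`" assembled STRICTLY from published theorems — so
that the rank-`≤ 1` remainder becomes exactly the CONSTRUCTION-SHAPED classes, which are TYPED
(missing-input `Prop`s), NOT attempted. This is not "finishing BSD". Team n1011: research route on
the CONSTRUCTION-SHAPED class X4 / §I N11 (route-1 PORT, (P-DER)); TOOL theorems of operator
algebra (no definition, no named fact, no `sorry`); curve-free, `p`-free.

## What (Mazur–Rubin, *Kolyvagin systems*, App. A, Lemma A.12 (i)(ii), in the case where every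
## Euler factor is the square of an augmentation element)

Setting (the currency of F1 `KolyvaginDerivativeAlgebra`): an `A`-module `X` (in the application
`X = H¹(U_n, T)`, `T`-LEVEL classes at the level `n`), pairwise commuting `σ_ℓ ∈ End_A X`
(`ℓ ∈ n`) with `σ_ℓ^{N_ℓ} = 1`, endomorphisms `F_ℓ` which are WORDS in the `σ`'s (the Frobenii
`conj(Fr_ℓ⁻¹)` on `H¹(U_n, T)`), polynomials `P_ℓ`, derivative operators
`D_m = ∏_{ℓ ∈ m} Σ_{i<N_ℓ} i σ_ℓ^i`, and a family `x_m ∈ X` (`m ⊆ n`) which is an EULER FAMILY: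
`σ_ℓ x_m = x_m` for `ℓ ∉ m` and the norm relations `N_{σ_ℓ} x_m = P_ℓ(F_ℓ) x_{m∖ℓ}` for `ℓ ∈ m`.
Two `σ`-stable submodules `S, V ≤ X` are given (in the application `S` = the classes vanishing at
every prime above a fixed `q ∈ n`, `V = M • S`) with `N_ℓ • S ⊆ V`, with `x_m ∈ S` whenever
`q ∈ m`, and with every Euler factor of the shape `P_ℓ = (X − 1)² + R_ℓ` where `R_ℓ(F_ℓ) S ⊆ V`
("`P_ℓ ≡ (X−1)²` modulo what sends `S` into `V`" — for `T_p E` at Kolyvagin primes for `M`,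
`P_ℓ ≡ (X−1)² mod M` coefficientwise).
* `sub_one_apply_mem_of_mem_closure` — LEMMA W: if `(σ_j − 1) y ∈ 𝒵` for all `j ∈ J` and `𝒵` is
  stable under the `σ_j`, then `(G − 1) y ∈ 𝒵` for every `G` in the monoid generated by the `σ_j`,
  `j ∈ J` (`(gh − 1) = g(h − 1) + (g − 1)`);
* `sub_one_apply_deriv_apply_mem_of_eulerFamily_sq` (abstract product operator `Dr`) and
  `sub_one_apply_noncommProd_deriv_apply_mem_of_eulerFamily_sq` (`Dr m = m.noncommProd D_•`) —
  **the augmentation-square lemma**: for every `m ⊆ n` with `q ∈ m`,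
  (ii) `(σ_j − 1)(D_m x_m) ∈ V` for every `j ≠ q`, and
  (i) `(σ_j − 1)((σ_ℓ − 1)(D_m x_m)) ∈ V` for all `j, ℓ`
  ([MR04] Lemma A.12: "(i) if `f ∈ 𝒜² + I ℤ[G(n)]` then `I⁻¹ f D_{mℓ} x_{mℓ} = 0` in `X̄_n`; (ii) …",
  specialised to `P_q ≡ (X−1)²`, where the term `ρ̃_ℓ(f) I⁻¹P_ℓ(Fr_ℓ⁻¹) D_m x_m` of (ii) disappears;
  by induction on `m`, the key case being
  `(σ_q − 1)² D_m x_m = N_q • D_{m∖q}((σ_q − 1) x_m) ∈ N_q • S ⊆ V`);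
* `sub_one_apply_noncommProd_deriv_apply_mem_of_mem_closure_erase` — CONSEQUENCE: for every word
  `G` in `{σ_j : j ≠ q}`, `(G − 1)(D_n x_n) ∈ V` — in the application, with `G = conj(Fr)` for a
  Frobenius `Fr` at `q` FIXING `K(q)` ([MR04] p. 85: "Fix a representative `Fr_ℓ ∈ G(n)` so that
  `Fr_ℓ = 1` on `ℚ(ℓ)`"), this is the input `(Fr − 1) D_n x″_n ∈ M • S` of the cocycle step (file 2
  `KolyvaginTransverseCocycle`) of THEOREM D-tr.
No division by `I`: membership in `V`, not an element `I⁻¹(…)`, is asserted, so no torsion-freeness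
of `X` is needed (the universal Euler system `X_n` of [Ru00] §4.2 / [MR04] p. 83 is not used).

References: B. Mazur, K. Rubin, *Kolyvagin systems*, Mem. AMS 799 (2004), App. A pp. 83–86
(eq. (34)–(35), Def. A.11, Lemma A.12, Prop. A.13); K. Rubin, *Euler Systems* (2000), §4.4.
-/

noncomputable section

open Finset Polynomial

universe u v w

namespace Summit.BirchSwinnertonDyer.Rank1Residual.GaloisImage

namespace Derivative

variable {A : Type u} [CommRing A] {X : Type v} [AddCommGroup X] [Module A X]
variable {ι : Type w}

/-! ### §1 Words in commuting operators: `(G − 1) y` lies where the `(σ_j − 1) y` lie -/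

/-- **LEMMA W.** Let `σ_j ∈ End_A X` (`j ∈ J`) be pairwise commuting and let `𝒵 ≤ X` be a
submodule stable under every `σ_j`, `j ∈ J`.  If `(σ_j − 1) y ∈ 𝒵` for all `j ∈ J`, then
`(G − 1) y ∈ 𝒵` for every `G` in the submonoid of `End_A X` generated by `{σ_j : j ∈ J}` (and `G`
maps `𝒵` into `𝒵`).  Proof: `(gh − 1) y = g((h − 1) y) + (g − 1) y`.  ([MR04] p. 85: "`𝒜` is
generated by the `σ_q − 1` for `q` dividing `n`".) [folklore] -/
theorem sub_one_apply_mem_of_mem_closure (σ : ι → Module.End A X) (J : Set ι) (𝒵 : Submodule A X)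
    (h𝒵 : ∀ j ∈ J, ∀ z ∈ 𝒵, σ j z ∈ 𝒵) {G : Module.End A X}
    (hG : G ∈ Submonoid.closure (σ '' J)) :
    (∀ z ∈ 𝒵, G z ∈ 𝒵) ∧ ∀ y : X, (∀ j ∈ J, (σ j - 1) y ∈ 𝒵) → (G - 1) y ∈ 𝒵 := by
  induction hG using Submonoid.closure_induction with
  | mem G hG =>
    obtain ⟨j, hj, rfl⟩ := hG
    exact ⟨fun z hz => h𝒵 j hj z hz, fun y hy => hy j hj⟩
  | one =>
    refine ⟨fun z hz => by simpa using hz, fun y _ => ?_⟩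
    simp
  | mul G H _ _ ihG ihH =>
    refine ⟨fun z hz => ?_, fun y hy => ?_⟩
    · rw [Module.End.mul_apply]
      exact ihG.1 _ (ihH.1 z hz)
    · have e : (G * H - 1) y = G ((H - 1) y) + (G - 1) y := by
        simp only [Module.End.mul_apply, LinearMap.sub_apply, Module.End.one_apply, map_sub]
        abel
      rw [e]
      exact 𝒵.add_mem (ihG.1 _ (ihH.2 y hy)) (ihG.2 y hy)

/-- LEMMA W, membership form: `(G − 1) y ∈ 𝒵`. [folklore] -/
theorem sub_one_apply_mem_of_mem_closure' (σ : ι → Module.End A X) (J : Set ι) (𝒵 : Submodule A X)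
    (h𝒵 : ∀ j ∈ J, ∀ z ∈ 𝒵, σ j z ∈ 𝒵) {G : Module.End A X}
    (hG : G ∈ Submonoid.closure (σ '' J)) {y : X} (hy : ∀ j ∈ J, (σ j - 1) y ∈ 𝒵) :
    (G - 1) y ∈ 𝒵 :=
  (sub_one_apply_mem_of_mem_closure σ J 𝒵 h𝒵 hG).2 y hy

/-- A word in operators preserving `𝒵` preserves `𝒵`. [folklore] -/
theorem apply_mem_of_mem_closure (σ : ι → Module.End A X) (J : Set ι) (𝒵 : Submodule A X)
    (h𝒵 : ∀ j ∈ J, ∀ z ∈ 𝒵, σ j z ∈ 𝒵) {G : Module.End A X}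
    (hG : G ∈ Submonoid.closure (σ '' J)) {z : X} (hz : z ∈ 𝒵) : G z ∈ 𝒵 :=
  (sub_one_apply_mem_of_mem_closure σ J 𝒵 h𝒵 hG).1 z hz

/-- `(σ − 1) z ∈ 𝒵` when `z ∈ 𝒵` and `σ` preserves `𝒵`. [folklore] -/
theorem sub_one_apply_mem_of_mem {σ : Module.End A X} {𝒵 : Submodule A X}
    (h𝒵 : ∀ z ∈ 𝒵, σ z ∈ 𝒵) {z : X} (hz : z ∈ 𝒵) : (σ - 1) z ∈ 𝒵 := by
  rw [LinearMap.sub_apply, Module.End.one_apply]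
  exact 𝒵.sub_mem (h𝒵 z hz) hz

/-- `P(F) y = (F − 1)((F − 1) y) + R(F) y` when `P = (X − C 1)^2 + R`. [folklore] -/
theorem aeval_sq_add_apply (F : Module.End A X) (R : A[X]) (y : X) :
    aeval F ((Polynomial.X - C 1) ^ 2 + R) y = (F - 1) ((F - 1) y) + aeval F R y := by
  rw [map_add, map_pow, map_sub, aeval_X, aeval_C, map_one, LinearMap.add_apply, pow_two,
    Module.End.mul_apply]

/-! ### §2 The augmentation-square lemma ([MR04] Lemma A.12 in the `(X−1)²` case) -/

section Abstract

variable [DecidableEq ι]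

/-- **The augmentation-square lemma, abstract product operator** ([MR04] Lemma A.12 (i)(ii) with
every `P_ℓ ≡ (X−1)²`).  Data as in F1 `apply_deriv_apply_eq_of_eulerFamily`: commuting `σ_ℓ`,
words `F_ℓ`, integers `N_ℓ` with `σ_ℓ^{N_ℓ} = 1`, polynomials `P_ℓ`, a product operator `Dr` with
`Dr (insert ℓ s) = D_ℓ * Dr s`, commuting with the `σ`'s and `F`'s and preserving `S`, an Euler
family `x` on the subsets of `n` (`hfix`, `hnorm`), `σ`-stable submodules `S, V` with
`N_ℓ • S ⊆ V`, `x_m ∈ S` for `q ∈ m`, and `P_ℓ = (X − 1)² + R_ℓ` with `R_ℓ(F_ℓ) S ⊆ V`.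
Conclusion, for every `m ⊆ n` with `q ∈ m`: (ii) `(σ_j − 1)(Dr m (x m)) ∈ V` for `j ∈ n`, `j ≠ q`;
(i) `(σ_j − 1)((σ_ℓ − 1)(Dr m (x m))) ∈ V` for all `j, ℓ ∈ n`.  By strong induction on `|m|`:
`(σ_ℓ − 1) D_m x_m = N_ℓ • D_{m∖ℓ} x_m − P_ℓ(F_ℓ) D_{m∖ℓ} x_{m∖ℓ}` (telescoping (34)), the
`(F_ℓ − 1)²`-part of the second term lying in `V` by (i) for `m ∖ ℓ` and LEMMA W twice; and
`(σ_q − 1)² D_m x_m = N_q • D_{m∖q}((σ_q − 1) x_m)` because `σ_q` fixes `x_{m∖q}`.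
[cite: MazurRubin2004, App. A, Lemma A.12 (p. 85)] -/
theorem sub_one_apply_deriv_apply_mem_of_eulerFamily_sq
    (σ F : ι → Module.End A X) (N : ι → ℕ) (P : ι → A[X]) (Dr : Finset ι → Module.End A X)
    (n : Finset ι) (x : Finset ι → X) (S V : Submodule A X) (q : ι) (hq : q ∈ n)
    (hσσ : ∀ a b, Commute (σ a) (σ b)) (hFσ : ∀ a b, Commute (F a) (σ b))
    (hFw : ∀ ℓ ∈ n, F ℓ ∈ Submonoid.closure (σ '' (↑n : Set ι)))
    (hDins : ∀ s ⊆ n, ∀ ℓ ∈ n, ℓ ∉ s →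
      Dr (insert ℓ s) = (∑ i ∈ range (N ℓ), (i : Module.End A X) * σ ℓ ^ i) * Dr s)
    (hσD : ∀ a s, Commute (σ a) (Dr s)) (hFD : ∀ a ∈ n, ∀ s, Commute (F a) (Dr s))
    (hDS : ∀ s ⊆ n, ∀ y ∈ S, Dr s y ∈ S)
    (hfix : ∀ m ⊆ n, ∀ ℓ ∈ n, ℓ ∉ m → σ ℓ (x m) = x m)
    (hord : ∀ ℓ ∈ n, σ ℓ ^ N ℓ = 1)
    (hnorm : ∀ m ⊆ n, ∀ ℓ ∈ m, (∑ i ∈ range (N ℓ), σ ℓ ^ i) (x m) = aeval (F ℓ) (P ℓ) (x (m.erase ℓ)))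
    (hS : ∀ ℓ ∈ n, ∀ y ∈ S, σ ℓ y ∈ S) (hV : ∀ ℓ ∈ n, ∀ y ∈ V, σ ℓ y ∈ V)
    (hNV : ∀ ℓ ∈ n, ∀ y ∈ S, (N ℓ : A) • y ∈ V)
    (hP : ∀ ℓ ∈ n, ∃ R : A[X], P ℓ = (Polynomial.X - C 1) ^ 2 + R ∧ ∀ y ∈ S, aeval (F ℓ) R y ∈ V)
    (hxS : ∀ m ⊆ n, q ∈ m → x m ∈ S) :
    ∀ m ⊆ n, q ∈ m →
      (∀ j ∈ n, j ≠ q → (σ j - 1) (Dr m (x m)) ∈ V) ∧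
        ∀ j ∈ n, ∀ ℓ ∈ n, (σ j - 1) ((σ ℓ - 1) (Dr m (x m))) ∈ V := by
  -- LEMMA W with `𝒵 = V`, `J = n`, as used for the words `F_ℓ`
  have hW : ∀ ℓ ∈ n, ∀ y : X, (∀ j ∈ n, (σ j - 1) y ∈ V) → (F ℓ - 1) y ∈ V := fun ℓ hℓ y hy =>
    sub_one_apply_mem_of_mem_closure' σ (↑n) V (fun j hj z hz => hV j hj z hz) (hFw ℓ hℓ) hy
  -- `(F_ℓ − 1)((F_ℓ − 1) w) ∈ V` as soon as all `(σ_j − 1)((σ_i − 1) w) ∈ V`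
  have hW2 : ∀ ℓ ∈ n, ∀ w : X, (∀ j ∈ n, ∀ i ∈ n, (σ j - 1) ((σ i - 1) w) ∈ V) →
      (F ℓ - 1) ((F ℓ - 1) w) ∈ V := by
    intro ℓ hℓ w hw
    refine hW ℓ hℓ _ fun j hj => ?_
    -- `(σ_j − 1)((F_ℓ − 1) w) = (F_ℓ − 1)((σ_j − 1) w)`
    have hc : Commute (σ j - 1) (F ℓ - 1) :=
      ((hFσ ℓ j).symm.sub_left (Commute.one_left _)).sub_right (Commute.one_right _)
    rw [apply_comm_of_commute hc]
    exact hW ℓ hℓ _ fun i hi => by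
      rw [apply_comm_of_commute (((hσσ i j).sub_left (Commute.one_left _)).sub_right
        (Commute.one_right _))]
      exact hw j hj i hi
  -- `(σ_a − 1)` commutes with `Dr s`
  have hσD' : ∀ a s, Commute (σ a - 1) (Dr s) := fun a s => (hσD a s).sub_left (Commute.one_left _)
  -- `(σ_j − 1)` preserves `S` and `V`
  have hS' : ∀ j ∈ n, ∀ y ∈ S, (σ j - 1) y ∈ S := fun j hj y hy =>
    sub_one_apply_mem_of_mem (hS j hj) hy
  have hV' : ∀ j ∈ n, ∀ y ∈ V, (σ j - 1) y ∈ V := fun j hj y hy =>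
    sub_one_apply_mem_of_mem (hV j hj) hy
  -- THE KEY IDENTITY (telescoping (34) + the norm relation): for `ℓ ∈ m ⊆ n`,
  -- `(σ_ℓ − 1)(D_m x_m) = N_ℓ • D_{m∖ℓ} x_m − P_ℓ(F_ℓ)(D_{m∖ℓ} x_{m∖ℓ})`
  have hkey : ∀ m ⊆ n, ∀ ℓ ∈ m, (σ ℓ - 1) (Dr m (x m)) =
      (N ℓ : A) • Dr (m.erase ℓ) (x m) - aeval (F ℓ) (P ℓ) (Dr (m.erase ℓ) (x (m.erase ℓ))) := by
    intro m hm ℓ hℓm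
    have hℓ : ℓ ∈ n := hm hℓm
    set s' := m.erase ℓ with hs'
    have hℓs' : ℓ ∉ s' := Finset.notMem_erase ℓ m
    have hs'n : s' ⊆ n := (Finset.erase_subset ℓ m).trans hm
    have hms : m = insert ℓ s' := (Finset.insert_erase hℓm).symm
    set z := Dr s' (x m) with hz
    have hzN : (σ ℓ ^ N ℓ) z = z := by rw [hord ℓ hℓ, Module.End.one_apply]
    have hDm : Dr m = (∑ i ∈ range (N ℓ), (i : Module.End A X) * σ ℓ ^ i) * Dr s' := by
      rw [hms]; exact hDins s' hs'n ℓ hℓ hℓs'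
    have hDs : Dr m (x m) = (∑ i ∈ range (N ℓ), (i : Module.End A X) * σ ℓ ^ i) z := by
      rw [hDm, Module.End.mul_apply]
    have htel := sub_one_deriv_apply_of_pow_apply_eq (σ ℓ) (N ℓ) z hzN
    have hc₁ : Commute (Dr s') (∑ i ∈ range (N ℓ), σ ℓ ^ i) :=
      commute_norm_of_commute (hσD ℓ s').symm (N ℓ)
    have hc₂ : Commute (Dr s') (aeval (F ℓ) (P ℓ)) :=
      commute_aeval_of_commute (hFD ℓ hℓ s').symm (P ℓ)
    have hnormz : (∑ i ∈ range (N ℓ), σ ℓ ^ i) z = aeval (F ℓ) (P ℓ) (Dr s' (x s')) := by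
      calc (∑ i ∈ range (N ℓ), σ ℓ ^ i) z
          = Dr s' ((∑ i ∈ range (N ℓ), σ ℓ ^ i) (x m)) := (apply_comm_of_commute hc₁ (x m)).symm
        _ = Dr s' (aeval (F ℓ) (P ℓ) (x s')) := by rw [hnorm m hm ℓ hℓm]
        _ = aeval (F ℓ) (P ℓ) (Dr s' (x s')) := apply_comm_of_commute hc₂ (x s')
    rw [hDs, htel, hnormz]
  -- for `ℓ ∈ n ∖ m`, `(σ_ℓ − 1)(D_m x_m) = 0`
  have hout : ∀ m ⊆ n, ∀ ℓ ∈ n, ℓ ∉ m → (σ ℓ - 1) (Dr m (x m)) = 0 := by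
    intro m hm ℓ hℓ hℓm
    rw [apply_comm_of_commute (hσD' ℓ m), LinearMap.sub_apply, Module.End.one_apply,
      hfix m hm ℓ hℓ hℓm, sub_self, map_zero]
  -- strong induction on `|m|`
  suffices h : ∀ k : ℕ, ∀ m ⊆ n, m.card = k → q ∈ m →
      (∀ j ∈ n, j ≠ q → (σ j - 1) (Dr m (x m)) ∈ V) ∧
        ∀ j ∈ n, ∀ ℓ ∈ n, (σ j - 1) ((σ ℓ - 1) (Dr m (x m))) ∈ V from
    fun m hm hqm => h m.card m hm rfl hqm
  intro k
  induction k using Nat.strong_induction_on with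
  | _ k ih =>
  intro m hm hcard hqm
  -- (ii): `(σ_j − 1)(D_m x_m) ∈ V` for `j ≠ q`
  have hii : ∀ j ∈ n, j ≠ q → (σ j - 1) (Dr m (x m)) ∈ V := by
    intro j hj hjq
    by_cases hjm : j ∈ m
    · obtain ⟨R, hPR, hR⟩ := hP j hj
      set s' := m.erase j with hs'
      have hs'n : s' ⊆ n := (Finset.erase_subset j m).trans hm
      have hqs' : q ∈ s' := Finset.mem_erase.mpr ⟨fun h => hjq (h ▸ rfl), hqm⟩
      have hcard' : s'.card < k := by rw [← hcard, hs']; exact Finset.card_erase_lt_of_mem hjm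
      -- induction hypothesis (i) at `m ∖ j`
      have IH := (ih s'.card hcard' s' hs'n rfl hqs').2
      rw [hkey m hm j hjm, hPR, aeval_sq_add_apply]
      refine V.sub_mem ?_ (V.add_mem ?_ ?_)
      · -- `N_j • D_{m∖j} x_m ∈ N_j • S ⊆ V`
        exact hNV j hj _ (hDS s' hs'n _ (hxS m hm hqm))
      · -- `(F_j − 1)² (D_{m∖j} x_{m∖j}) ∈ V` by (i) for `m ∖ j` and LEMMA W twice
        exact hW2 j hj _ fun j' hj' i hi => IH j' hj' i hi
      · -- `R_j(F_j)(D_{m∖j} x_{m∖j}) ∈ V` since `D_{m∖j} x_{m∖j} ∈ S`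
        exact hR _ (hDS s' hs'n _ (hxS s' hs'n hqs'))
    · rw [hout m hm j hj hjm]
      exact V.zero_mem
  refine ⟨hii, fun j hj ℓ hℓ => ?_⟩
  -- (i): `(σ_j − 1)((σ_ℓ − 1)(D_m x_m)) ∈ V`
  by_cases hℓm : ℓ ∈ m
  swap
  · rw [hout m hm ℓ hℓ hℓm, map_zero]; exact V.zero_mem
  by_cases hℓq : ℓ = q
  swap
  · exact hV' j hj _ (hii ℓ hℓ hℓq)
  subst hℓq
  by_cases hjq : j = ℓ
  swap
  · -- `(σ_j − 1)(σ_q − 1) = (σ_q − 1)(σ_j − 1)` and `(σ_j − 1)(D_m x_m) ∈ V`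
    have hc : Commute (σ j - 1) (σ ℓ - 1) :=
      ((hσσ j ℓ).sub_left (Commute.one_left _)).sub_right (Commute.one_right _)
    rw [apply_comm_of_commute hc]
    exact hV' ℓ hℓ _ (hii j hj hjq)
  subst hjq
  -- the key case `(σ_q − 1)² D_m x_m = N_q • D_{m∖q}((σ_q − 1) x_m)`
  set s' := m.erase j with hs'
  have hs'n : s' ⊆ n := (Finset.erase_subset j m).trans hm
  have hjs' : j ∉ s' := Finset.notMem_erase j m
  rw [hkey m hm j hℓm, map_sub, LinearMap.map_smul_of_tower,
    apply_comm_of_commute (hσD' j s') (x m)]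
  have hPz : (σ j - 1) (aeval (F j) (P j) (Dr s' (x s'))) = 0 := by
    have hc : Commute (σ j - 1) (aeval (F j) (P j)) :=
      commute_aeval_of_commute ((hFσ j j).symm.sub_left (Commute.one_left _)) (P j)
    rw [apply_comm_of_commute hc, apply_comm_of_commute (hσD' j s') (x s'),
      LinearMap.sub_apply, Module.End.one_apply, hfix s' hs'n j hj hjs', sub_self, map_zero,
      map_zero]
  rw [hPz, sub_zero]
  exact hNV j hj _ (hDS s' hs'n _ (hS' j hj _ (hxS m hm hqm)))

/-- **CONSEQUENCE: every word in `{σ_j : j ≠ q}` moves `D_n x_n` into `V`** — under the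
hypotheses of `sub_one_apply_deriv_apply_mem_of_eulerFamily_sq`, for every `G` in the submonoid
generated by the `σ_j`, `j ∈ n`, `j ≠ q`: `(G − 1)(Dr n (x n)) ∈ V`.  In the application `G` is
`conj(Fr)` for a Frobenius `Fr` at `q` acting trivially on `K(q)` and `V = M • S`: the input
`Fr · D_n x″_n − D_n x″_n ∈ M • S` of the cocycle step of THEOREM D-tr.
[cite: MazurRubin2004, App. A, Lemma A.12 and Prop. A.13 (pp. 85–86)] -/
theorem sub_one_apply_deriv_apply_mem_of_mem_closure_erase
    (σ F : ι → Module.End A X) (N : ι → ℕ) (P : ι → A[X]) (Dr : Finset ι → Module.End A X)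
    (n : Finset ι) (x : Finset ι → X) (S V : Submodule A X) (q : ι) (hq : q ∈ n)
    (hσσ : ∀ a b, Commute (σ a) (σ b)) (hFσ : ∀ a b, Commute (F a) (σ b))
    (hFw : ∀ ℓ ∈ n, F ℓ ∈ Submonoid.closure (σ '' (↑n : Set ι)))
    (hDins : ∀ s ⊆ n, ∀ ℓ ∈ n, ℓ ∉ s →
      Dr (insert ℓ s) = (∑ i ∈ range (N ℓ), (i : Module.End A X) * σ ℓ ^ i) * Dr s)
    (hσD : ∀ a s, Commute (σ a) (Dr s)) (hFD : ∀ a ∈ n, ∀ s, Commute (F a) (Dr s))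
    (hDS : ∀ s ⊆ n, ∀ y ∈ S, Dr s y ∈ S)
    (hfix : ∀ m ⊆ n, ∀ ℓ ∈ n, ℓ ∉ m → σ ℓ (x m) = x m)
    (hord : ∀ ℓ ∈ n, σ ℓ ^ N ℓ = 1)
    (hnorm : ∀ m ⊆ n, ∀ ℓ ∈ m, (∑ i ∈ range (N ℓ), σ ℓ ^ i) (x m) = aeval (F ℓ) (P ℓ) (x (m.erase ℓ)))
    (hS : ∀ ℓ ∈ n, ∀ y ∈ S, σ ℓ y ∈ S) (hV : ∀ ℓ ∈ n, ∀ y ∈ V, σ ℓ y ∈ V)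
    (hNV : ∀ ℓ ∈ n, ∀ y ∈ S, (N ℓ : A) • y ∈ V)
    (hP : ∀ ℓ ∈ n, ∃ R : A[X], P ℓ = (Polynomial.X - C 1) ^ 2 + R ∧ ∀ y ∈ S, aeval (F ℓ) R y ∈ V)
    (hxS : ∀ m ⊆ n, q ∈ m → x m ∈ S)
    {G : Module.End A X} (hG : G ∈ Submonoid.closure (σ '' {j | j ∈ n ∧ j ≠ q})) :
    (G - 1) (Dr n (x n)) ∈ V := by
  have h := (sub_one_apply_deriv_apply_mem_of_eulerFamily_sq σ F N P Dr n x S V q hq hσσ hFσ hFw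
    hDins hσD hFD hDS hfix hord hnorm hS hV hNV hP hxS n subset_rfl hq).1
  refine sub_one_apply_mem_of_mem_closure' σ {j | j ∈ n ∧ j ≠ q} V
    (fun j hj z hz => hV j hj.1 z hz) hG fun j hj => h j hj.1 hj.2

end Abstract

/-! ### §3 The same for `Dr m = m.noncommProd D_•` (the form consumed by the cohomological
instantiation, as F1 `apply_noncommProd_deriv_apply_eq_of_eulerFamily`) -/

section NoncommProd

variable [DecidableEq ι]

/-- `Σ_{i<N} i σ^i` preserves every submodule preserved by `σ`. [folklore] -/
theorem deriv_apply_mem_of_forall_mem (σ : Module.End A X) (N : ℕ) (S : Submodule A X)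
    (hS : ∀ y ∈ S, σ y ∈ S) {y : X} (hy : y ∈ S) :
    (∑ i ∈ range N, (i : Module.End A X) * σ ^ i) y ∈ S := by
  have hpow : ∀ i : ℕ, ∀ y ∈ S, (σ ^ i) y ∈ S := fun i => by
    induction i with
    | zero => intro y hy; simpa using hy
    | succ i ih => intro y hy; rw [pow_succ, Module.End.mul_apply]; exact ih _ (hS y hy)
  rw [LinearMap.sum_apply]
  refine S.sum_mem fun i _ => ?_
  rw [Module.End.mul_apply, Module.End.natCast_apply]
  exact S.nsmul_mem (hpow i y hy) i

omit [DecidableEq ι] in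
/-- `m.noncommProd D_•` preserves every submodule preserved by all the `σ_ℓ`. [folklore] -/
theorem noncommProd_deriv_apply_mem_of_forall_mem (σ : ι → Module.End A X) (N : ι → ℕ)
    (hσσ : ∀ a b, Commute (σ a) (σ b)) (S : Submodule A X) (m : Finset ι)
    (hS : ∀ ℓ ∈ m, ∀ y ∈ S, σ ℓ y ∈ S) {y : X} (hy : y ∈ S) :
    (m.noncommProd (fun ℓ => ∑ i ∈ range (N ℓ), (i : Module.End A X) * σ ℓ ^ i)
      fun a _ b _ _ => commute_deriv_deriv hσσ N a b) y ∈ S := by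
  have h := Finset.noncommProd_induction m
    (fun ℓ => ∑ i ∈ range (N ℓ), (i : Module.End A X) * σ ℓ ^ i)
    (fun a _ b _ _ => commute_deriv_deriv hσσ N a b) (fun g : Module.End A X => ∀ y ∈ S, g y ∈ S)
    (fun a b ha hb y hy => by rw [Module.End.mul_apply]; exact ha _ (hb y hy))
    (fun y hy => by simpa using hy)
    (fun ℓ hℓ y hy => deriv_apply_mem_of_forall_mem (σ ℓ) (N ℓ) S (hS ℓ hℓ) hy)
  exact h y hy

/-- **The augmentation-square lemma for `D_m = m.noncommProd D_•`** ([MR04] Lemma A.12 in the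
`(X−1)²` case): clauses (ii) and (i) for every `m ⊆ n` containing `q`, and the consequence
`(G − 1)(D_n x_n) ∈ V` for every word `G` in `{σ_j : j ∈ n, j ≠ q}`.  Hypotheses: the Euler family
`x` (`hfix`, `hnorm`) of F1 with `σ_ℓ^{N_ℓ} = 1`, words `F_ℓ` commuting with the `σ`'s,
`σ`-stable submodules `S, V` with `N_ℓ • S ⊆ V`, `x_m ∈ S` for `q ∈ m`, and
`P_ℓ = (X − 1)² + R_ℓ` with `R_ℓ(F_ℓ) S ⊆ V`.
[cite: MazurRubin2004, App. A, Lemma A.12 (p. 85)] -/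
theorem sub_one_apply_noncommProd_deriv_apply_mem_of_eulerFamily_sq
    (σ F : ι → Module.End A X) (N : ι → ℕ) (P : ι → A[X]) (n : Finset ι) (x : Finset ι → X)
    (S V : Submodule A X) (q : ι) (hq : q ∈ n)
    (hσσ : ∀ a b, Commute (σ a) (σ b)) (hFσ : ∀ a b, Commute (F a) (σ b))
    (hFw : ∀ ℓ ∈ n, F ℓ ∈ Submonoid.closure (σ '' (↑n : Set ι)))
    (hfix : ∀ m ⊆ n, ∀ ℓ ∈ n, ℓ ∉ m → σ ℓ (x m) = x m)
    (hord : ∀ ℓ ∈ n, σ ℓ ^ N ℓ = 1)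
    (hnorm : ∀ m ⊆ n, ∀ ℓ ∈ m, (∑ i ∈ range (N ℓ), σ ℓ ^ i) (x m) = aeval (F ℓ) (P ℓ) (x (m.erase ℓ)))
    (hS : ∀ ℓ ∈ n, ∀ y ∈ S, σ ℓ y ∈ S) (hV : ∀ ℓ ∈ n, ∀ y ∈ V, σ ℓ y ∈ V)
    (hNV : ∀ ℓ ∈ n, ∀ y ∈ S, (N ℓ : A) • y ∈ V)
    (hP : ∀ ℓ ∈ n, ∃ R : A[X], P ℓ = (Polynomial.X - C 1) ^ 2 + R ∧ ∀ y ∈ S, aeval (F ℓ) R y ∈ V)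
    (hxS : ∀ m ⊆ n, q ∈ m → x m ∈ S) :
    (∀ m ⊆ n, q ∈ m →
      (∀ j ∈ n, j ≠ q → (σ j - 1)
          ((m.noncommProd (fun ℓ => ∑ i ∈ range (N ℓ), (i : Module.End A X) * σ ℓ ^ i)
            fun a _ b _ _ => commute_deriv_deriv hσσ N a b) (x m)) ∈ V) ∧
        ∀ j ∈ n, ∀ ℓ ∈ n, (σ j - 1) ((σ ℓ - 1)
          ((m.noncommProd (fun ℓ => ∑ i ∈ range (N ℓ), (i : Module.End A X) * σ ℓ ^ i)
            fun a _ b _ _ => commute_deriv_deriv hσσ N a b) (x m))) ∈ V) ∧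
      ∀ G ∈ Submonoid.closure (σ '' {j | j ∈ n ∧ j ≠ q}),
        (G - 1) ((n.noncommProd (fun ℓ => ∑ i ∈ range (N ℓ), (i : Module.End A X) * σ ℓ ^ i)
          fun a _ b _ _ => commute_deriv_deriv hσσ N a b) (x n)) ∈ V := by
  set Dr : Finset ι → Module.End A X := fun s =>
    s.noncommProd (fun ℓ => ∑ i ∈ range (N ℓ), (i : Module.End A X) * σ ℓ ^ i)
      fun a _ b _ _ => commute_deriv_deriv hσσ N a b with hDr
  have hDins : ∀ s ⊆ n, ∀ ℓ ∈ n, ℓ ∉ s →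
      Dr (insert ℓ s) = (∑ i ∈ range (N ℓ), (i : Module.End A X) * σ ℓ ^ i) * Dr s :=
    fun s _ ℓ _ hℓ => Finset.noncommProd_insert_of_notMem s ℓ _ _ hℓ
  have hσD : ∀ a s, Commute (σ a) (Dr s) := fun a s =>
    Finset.noncommProd_commute _ _ _ _ fun b _ => commute_deriv_of_commute (hσσ a b) (N b)
  have hFD : ∀ a ∈ n, ∀ s, Commute (F a) (Dr s) := fun a _ s =>
    Finset.noncommProd_commute _ _ _ _ fun b _ => commute_deriv_of_commute (hFσ a b) (N b)
  have hDS : ∀ s ⊆ n, ∀ y ∈ S, Dr s y ∈ S := fun s hs y hy =>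
    noncommProd_deriv_apply_mem_of_forall_mem σ N hσσ S s (fun ℓ hℓ => hS ℓ (hs hℓ)) hy
  refine ⟨fun m hm hqm => ?_, fun G hG => ?_⟩
  · exact sub_one_apply_deriv_apply_mem_of_eulerFamily_sq σ F N P Dr n x S V q hq hσσ hFσ hFw
      hDins hσD hFD hDS hfix hord hnorm hS hV hNV hP hxS m hm hqm
  · exact sub_one_apply_deriv_apply_mem_of_mem_closure_erase σ F N P Dr n x S V q hq hσσ hFσ hFw
      hDins hσD hFD hDS hfix hord hnorm hS hV hNV hP hxS hG

end NoncommProd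

end Derivative

end Summit.BirchSwinnertonDyer.Rank1Residual.GaloisImage

end
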